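import Literature.MathematicalPhysics.QuantumFieldTheory.BalabanImbrieJaffe1984to88.BIJ88ProductRuleAllOrders306

/-!
# `BalabanImbrieJaffe1984to88.BIJ88DsetNormBound306` — T. Bałaban, J. Imbrie, A. Jaffe, *Effective action and cluster properties of the
abelian Higgs model*, Commun. Math. Phys. **114** (1988) 257–315 [BalabanImbrieJaffe1988]: pp. 305–307 [PDF 49–51] (Sect. 5.13) and p. 309
[PDF 53] (Sect. 5.14) — **THE SIZE OF AN ITERATED FIELD DERIVATIVE OF A SMOOTH FACTOR**.  Print bounds every functional derivative that a
train deposits on a factor by a constant attached to that factor and the number of hits: p. 307, *"Functional derivatives hitting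
e^{−V^{(k)}(Y)} yield factors e^β(L^kε/ε₀)^{1/4−α}"*, *"(Factorials can be produced when many functional derivatives hit the same object,
for example a characteristic function.)"*; p. 309, *"Each factor V^{(k)}(Y) in Π(d/dt)_{γ_j} produces a factor … obtained in the Gaussian
integration estimate, using the fact that V^{(k)}(Y) is a small polynomial"*.  In the tree the hits are p13's iterated directional derivative
`BIJ88WickSourceSmooth305.dset u D` (legs `j ∈ D`, directions `u_j`) and the factors are members of `BIJ88SmoothFactors5133.CbInf` (`C^∞` with
every Fréchet derivative bounded, `‖DⁿG‖ ≤ K_n`).  THIS FILE is the bridge between the two languages: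

  `|∂_{u_D} G(φ)| ≤ ‖D^{|D|}G(φ)‖ · Π_{j∈D} ‖u_j‖`,  hence  `≤ K_{|D|} · Π_{j∈D} ‖u_j‖`  for `G ∈ C_b^∞`,

and `≤ K_{|D|}` for coordinate legs `u_j = e_{q_j}` — the form in which an all-orders letter `‖Dⁿ[∂_t^m e^{−tV_Y}]‖ ≤ K_Y^{(m,n)}` on a
`V`-slot (row C2.Eq5.14.3-5.14.4, §f typing gap #1: `V_Y ∈ C_b^∞` carried as a named hypothesis) bounds every term that
`BIJ88ProductRuleAllOrders306.dset_fD_uD_apply` assigns to that slot.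

statement-level skeleton of published theorems with citation tags; proofs where landed; nothing here is a claim about the Yang–Mills mass gap

PDF held: `paper:balaban1988-cmp114-bij-abelian-higgs-effective-action` (journal page = PDF page + 256); pages re-read this session as text:
PDF 51 (p. 307) L10–18, PDF 53 (p. 309) L16–19.

CITATION HEADER (lean-in-tree rule).  Part of the lit-balaban TYPED SKELETON (HOME `run/shared/lean/pub/lit-balaban/`), Phase 2, seat p36
(gen 21, unit `lit-balaban-p36`); rows **C2.Eq5.14.3-5.14.4** (member: §f estimate E1 — the cost of the legs landing on a `V`-slot, or on any
`C_b^∞` slot, in the assignment sums of bricks 7–9) and C2.Eq5.13.3-5.13.4 (member: calculus of p13's `dset`) of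
`HOME/lit-balaban-r16/ROWS-C2-part2.md`.
WHAT IS REPRODUCED (theorem-only; no definitions, no `Prop` facts; axioms standard):
* `norm_iteratedFDeriv_fderiv_apply_le` (`‖Dⁿ[∂_vG]‖ ≤ ‖v‖‖D^{n+1}G‖`), **`abs_dset_le_norm_iteratedFDeriv`** (the display, `G` smooth),
  `abs_dset_le_of_cbInf_bound` (with the `C_b^∞` constants), `norm_single_le_one` / **`abs_dset_single_le`** (coordinate legs:
  `|∂_{q_D}G(φ)| ≤ ‖D^{|D|}G(φ)‖`), `abs_dset_single_le_of_bound` (an all-orders letter `‖DⁿG(φ)‖ ≤ B n φ` bounds every coordinate `dset`).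
HONEST SCOPE.  Sizes only; which constants are SMALL (print's `e^β(L^kε/ε₀)^{1/4−α}` per hit on `e^{−V(Y)}`, from the small coefficients of
the polynomial `V`) is a letter on `V`, not derived here.
-/

namespace Literature.MathematicalPhysics.QuantumFieldTheory.BalabanImbrieJaffe1984to88.BIJ88DsetNormBound306

open Finset Function
open scoped BigOperators ContDiff
open BIJ88WickSourceSmooth305 (dset dset_empty dset_insert_max)
open BIJ88SmoothFactors5133 (CbInf)

variable {S : Type} [Fintype S] {κ : Type} [LinearOrder κ]

/-- `‖Dⁿ[φ ↦ DG(φ)v](φ)‖ ≤ ‖v‖ · ‖D^{n+1}G(φ)‖` for `G` smooth. [cite: BalabanImbrieJaffe1988, §5.13 p.305] -/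
theorem norm_iteratedFDeriv_fderiv_apply_le {G : (S → ℝ) → ℝ} (hG : ContDiff ℝ ∞ G) (v : S → ℝ) (n : ℕ) (φ : S → ℝ) :
    ‖iteratedFDeriv ℝ n (fun ψ => fderiv ℝ G ψ v) φ‖ ≤ ‖v‖ * ‖iteratedFDeriv ℝ (n + 1) G φ‖ := by
  rw [← norm_iteratedFDeriv_fderiv]
  exact norm_iteratedFDeriv_clm_apply_const ((hG.fderiv_right (m := ∞) le_rfl).contDiffAt) (mod_cast le_top)

/-- **THE SIZE OF AN ITERATED DIRECTIONAL DERIVATIVE**: `|∂_{u_D} G(φ)| ≤ ‖D^{|D|}G(φ)‖ · Π_{j∈D} ‖u_j‖` for smooth `G` — each leg costs the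
sup norm of its direction and raises the order of the Fréchet derivative by one (p. 307 *"Factorials can be produced when many functional
derivatives hit the same object"*: they sit in `‖D^{|D|}G‖`). [cite: BalabanImbrieJaffe1988, §5.13 p.307] -/
theorem abs_dset_le_norm_iteratedFDeriv (u : κ → S → ℝ) (D : Finset κ) {G : (S → ℝ) → ℝ} (hG : ContDiff ℝ ∞ G) (φ : S → ℝ) :
    |dset u D G φ| ≤ ‖iteratedFDeriv ℝ D.card G φ‖ * ∏ j ∈ D, ‖u j‖ := by
  induction D using Finset.induction_on_max generalizing G with
  | empty =>
    rw [dset_empty, Finset.card_empty, Finset.prod_empty, mul_one, norm_iteratedFDeriv_zero, Real.norm_eq_abs]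
  | insert a s ha ih =>
    have has : a ∉ s := fun h => lt_irrefl a (ha a h)
    rw [dset_insert_max u ha, Finset.card_insert_of_notMem has, Finset.prod_insert has]
    refine (ih (BIJ88ProductRuleAllOrders306.contDiff_fderiv_apply hG (u a))).trans ?_
    calc ‖iteratedFDeriv ℝ s.card (fun ψ => fderiv ℝ G ψ (u a)) φ‖ * ∏ j ∈ s, ‖u j‖
        ≤ (‖u a‖ * ‖iteratedFDeriv ℝ (s.card + 1) G φ‖) * ∏ j ∈ s, ‖u j‖ :=
          mul_le_mul_of_nonneg_right (norm_iteratedFDeriv_fderiv_apply_le hG (u a) s.card φ) (prod_nonneg fun _ _ => norm_nonneg _)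
      _ = ‖iteratedFDeriv ℝ (s.card + 1) G φ‖ * (‖u a‖ * ∏ j ∈ s, ‖u j‖) := by ring

/-- **… with the `C_b^∞` constants**: if `‖DⁿG‖ ≤ K_n` everywhere then `|∂_{u_D}G(φ)| ≤ K_{|D|} · Π_{j∈D}‖u_j‖` (p. 309: each hit on a
`V`-slot costs the constant of that slot; p. 307: *"Functional derivatives hitting e^{−V^{(k)}(Y)} yield factors …"*).
[cite: BalabanImbrieJaffe1988, §5.13 p.307, (5.14.3)–(5.14.4) p.309] -/
theorem abs_dset_le_of_cbInf_bound (u : κ → S → ℝ) (D : Finset κ) {G : (S → ℝ) → ℝ} (hG : CbInf G) {K : ℕ → ℝ}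
    (hK : ∀ n φ, ‖iteratedFDeriv ℝ n G φ‖ ≤ K n) (φ : S → ℝ) : |dset u D G φ| ≤ K D.card * ∏ j ∈ D, ‖u j‖ :=
  (abs_dset_le_norm_iteratedFDeriv u D hG.1 φ).trans (mul_le_mul_of_nonneg_right (hK _ _) (prod_nonneg fun _ _ => norm_nonneg _))

variable [DecidableEq S]

/-- a coordinate direction has sup norm at most one. [cite: BalabanImbrieJaffe1988, §5.13 p.306] -/
theorem norm_single_le_one (q : S) : ‖(Pi.single q (1 : ℝ) : S → ℝ)‖ ≤ 1 := by
  refine (pi_norm_le_iff_of_nonneg zero_le_one).2 fun x => ?_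
  by_cases h : x = q
  · subst h; simp
  · rw [Pi.single_eq_of_ne h]; simp

/-- **COORDINATE LEGS**: `|∂_{q_D} G(φ)| ≤ ‖D^{|D|}G(φ)‖` for legs along `e_{q_j}` (the legs of the trains of (5.13.3),
`BIJ88TrainsDsetExpansion306`). [cite: BalabanImbrieJaffe1988, §5.13 Eq. (5.13.3) p.306, p.307] -/
theorem abs_dset_single_le (q : κ → S) (D : Finset κ) {G : (S → ℝ) → ℝ} (hG : ContDiff ℝ ∞ G) (φ : S → ℝ) :
    |dset (fun j => Pi.single (q j) (1 : ℝ)) D G φ| ≤ ‖iteratedFDeriv ℝ D.card G φ‖ := by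
  refine (abs_dset_le_norm_iteratedFDeriv _ D hG φ).trans ?_
  have h1 : ∏ j ∈ D, ‖(Pi.single (q j) (1 : ℝ) : S → ℝ)‖ ≤ 1 :=
    Finset.prod_le_one (fun _ _ => norm_nonneg _) fun j _ => norm_single_le_one (q j)
  calc ‖iteratedFDeriv ℝ D.card G φ‖ * ∏ j ∈ D, ‖(Pi.single (q j) (1 : ℝ) : S → ℝ)‖
      ≤ ‖iteratedFDeriv ℝ D.card G φ‖ * 1 := mul_le_mul_of_nonneg_left h1 (norm_nonneg _)
    _ = _ := mul_one _

/-- **an all-orders letter on a slot bounds every assignment of legs to it**: if `‖DⁿG(φ)‖ ≤ B n φ` for all `n` (e.g. the letter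
`‖Dⁿ[∂_t^m e^{−tV_Y}](φ)‖ ≤ K_Y^{(m,n)}` of a `V`-slot, or the shell-supported bound of a χ-slot) then `|∂_{q_D}G(φ)| ≤ B |D| φ`.
[cite: BalabanImbrieJaffe1988, §5.13 p.307, (5.14.3)–(5.14.4) p.309] -/
theorem abs_dset_single_le_of_bound (q : κ → S) (D : Finset κ) {G : (S → ℝ) → ℝ} (hG : ContDiff ℝ ∞ G) {B : ℕ → (S → ℝ) → ℝ}
    (hB : ∀ n φ, ‖iteratedFDeriv ℝ n G φ‖ ≤ B n φ) (φ : S → ℝ) :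
    |dset (fun j => Pi.single (q j) (1 : ℝ)) D G φ| ≤ B D.card φ :=
  (abs_dset_single_le q D hG φ).trans (hB _ _)

end Literature.MathematicalPhysics.QuantumFieldTheory.BalabanImbrieJaffe1984to88.BIJ88DsetNormBound306
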